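import Literature.NumberTheory.Transcendental.KZSemiCanonicalReductionProofs
import Summits.KontsevichZagierPeriods.KontsevichZagierPeriods.Theorems.HurwitzMicroSectorsNormalFormPrincipleDlogMoves
import Summits.KontsevichZagierPeriods.KontsevichZagierPeriods.Theorems.HurwitzMicroSectorsNormalFormPrincipleSplitMoves

/-!
# `NormalFormPrinciple` (stmt-KontsevichZagierPeriods-3869), line `SketchIdeator1` — the registered
# sub-goal `slab_sub_pt_mem_relations`, assembled in two moves from landed lemmas

Pure proof file (`--supports` the crux; siege variant "reduce to landed lemmas of this crux, then
assemble"). The registered sub-goal `slab_sub_pt_mem_relations` of the leaf `stub_boxRigidity`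
(dimension one, split denominators) is **Newton–Leibniz over the point**: for rationals `α ≤ β`,
an interval representation `N = [(α,β), f]` whose integrand has a `ℚ`-rational primitive
`F = P_F/Q_F` (`Q_F ≠ 0` on `[α,β]`) satisfies `[N] − [pt, F(β) − F(α)] ∈ relations`. It is proved
here by name and with the registered signature, in its own namespace `PiBox.SlabPointNullGlue`.

The assembly is exactly two moves, each discharged by an already LANDED lemma:

* `[N] − [R] ∈ relations` for the closed-slab representation `R = [[α,β], f]` — ONE null
  modification, `KZ.of_sub_of_mem_relations_of_null` (`N ⊆ R`, and `R ∖ N` is the two endpoint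
  hyperplanes, null by the crux lemma `Dlog.volume_slab` and `Set.Icc_sdiff_Ioo_same`); the same
  null set makes `f` integrable on the closed slab (`IntegrableOn.mono_set_ae`);
* `[R] − [Z] ∈ newtonLeibnizRel` — ONE printed rule (3) over the base `ℝ⁰`, band `[α, β]`,
  primitive `z ↦ F (z 0)` (semialgebraic by the crux lemma `Dlog.isSemialgebraicFunOn_polynomial_div`
  on the slab `Dlog.isSemialgebraic_Icc₁`).

This certificate is independent of the two others in the tree — `PiBox.Dlog.slab_sub_pt_mem_relations`
(rule (3) + restriction + congruence) and `PiBox.SlabMathlib.slab_sub_pt_mem_relations` (rule (3) +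
domain additivity + junk rim): neither is invoked, and no representation other than `R` is built.

Sources: M. Kontsevich, D. Zagier, *Periods* (2001), §1.2 rules (1), (3). No definitions.
-/

noncomputable section

open MeasureTheory Set
open scoped Polynomial
open Literature.NumberTheory.Transcendental Literature.NumberTheory.Transcendental.KZ
open Literature.ModelTheory.ExponentialFields (IsSemialgebraic isSemialgebraic_univ)

namespace Summit.KontsevichZagierPeriods.HurwitzMicroSectors.NormalFormPrinciple.PiBox

namespace SlabPointNullGlue

open Summit.KontsevichZagierPeriods.HurwitzMicroSectors.NormalFormPrinciple.PiBox.Dlog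
  (volume_slab isSemialgebraic_Icc₁ isSemialgebraicFunOn_polynomial_div)

/-- The closed slab minus the open slab with the same ends is null in `ℝ¹`: it is the union of the
two endpoint hyperplanes. [folklore] -/
theorem volume_slab_Icc_diff_Ioo {a b : ℝ} (hab : a ≤ b) :
    volume ({x : Fin 1 → ℝ | x 0 ∈ Set.Icc a b} \ {x | x 0 ∈ Set.Ioo a b}) = 0 := by
  have hset : {x : Fin 1 → ℝ | x 0 ∈ Set.Icc a b} \ {x | x 0 ∈ Set.Ioo a b} =
      {x : Fin 1 → ℝ | x 0 ∈ Set.Icc a b \ Set.Ioo a b} := rfl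
  rw [hset, volume_slab, Set.Icc_sdiff_Ioo_same hab]
  exact (Set.toFinite _).measure_zero _

/-- **Newton–Leibniz over the point** (registered sub-goal `slab_sub_pt_mem_relations` of crux
stmt-KontsevichZagierPeriods-3869, verbatim signature). Let `α ≤ β` be rational, `N = [(α,β), f]`
an interval representation whose integrand `x ↦ f(x₀)` is `ℚ`-semialgebraic on the closed slab,
and `F = P_F/Q_F` (`P_F, Q_F ∈ ℚ[X]`, `Q_F ≠ 0` on `[α,β]`) a primitive of `f` on `(α,β)`. Then
`[N] − [pt, F(β) − F(α)] ∈ relations` for every point representation with that constant.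
Proof: `[N] − [Z] = ([N] − [R]) + ([R] − [Z])` with `R = [[α,β], f]` — one null modification
(rule 1) and one Newton–Leibniz move over `ℝ⁰` (rule 3).
[cite: KontsevichZagier2001, §1.2 rules (1), (3)] -/
theorem slab_sub_pt_mem_relations {α β : ℚ} (hαβ : α ≤ β) (f : ℝ → ℝ) (PF QF : ℚ[X])
    (hQF : ∀ t ∈ Set.Icc (α:ℝ) β, (Polynomial.aeval t QF : ℝ) ≠ 0)
    (hderiv : ∀ t ∈ Set.Ioo (α:ℝ) β,
      HasDerivAt (fun u : ℝ => (Polynomial.aeval u PF : ℝ) / Polynomial.aeval u QF) (f t) t)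
    (hf : IsSemialgebraicFunOn ℚ {x : Fin 1 → ℝ | x 0 ∈ Set.Icc (α:ℝ) β} (fun x => f (x 0)))
    (N : IntegralRep 1) (hNd : N.domain = {x | x 0 ∈ Set.Ioo (α:ℝ) β})
    (hNi : EqOn N.integrand (fun x => f (x 0)) N.domain)
    (Z : IntegralRep 0) (hZd : Z.domain = univ)
    (hZi : Z.integrand = fun _ => (Polynomial.aeval (β:ℝ) PF : ℝ) / Polynomial.aeval (β:ℝ) QF -
      (Polynomial.aeval (α:ℝ) PF : ℝ) / Polynomial.aeval (α:ℝ) QF) :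
    of N - of Z ∈ relations := by
  have hαβ' : (α:ℝ) ≤ β := by exact_mod_cast hαβ
  have hCsa : IsSemialgebraic ℚ {x : Fin 1 → ℝ | x 0 ∈ Set.Icc (α:ℝ) β} := isSemialgebraic_Icc₁ α β
  have hnull : volume ({x : Fin 1 → ℝ | x 0 ∈ Set.Icc (α:ℝ) β} \ {x | x 0 ∈ Set.Ioo (α:ℝ) β}) = 0 :=
    volume_slab_Icc_diff_Ioo hαβ'
  -- `f` is integrable on the closed slab: it is `N.integrand` on the open slab, a.e. the same set
  have hfi : IntegrableOn (fun x : Fin 1 → ℝ => f (x 0)) {x : Fin 1 → ℝ | x 0 ∈ Set.Icc (α:ℝ) β} := by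
    have h1 : IntegrableOn (fun x : Fin 1 → ℝ => f (x 0)) N.domain :=
      N.integrableOn.congr_fun hNi (IsSemialgebraic.measurableSet_holds N.isSemialgebraic_domain)
    rw [hNd] at h1
    exact h1.mono_set_ae (ae_le_set.mpr hnull)
  -- the closed-slab representation `R = [[α,β], f]`
  obtain ⟨R, hRd, hRi⟩ : ∃ R : IntegralRep 1,
      R.domain = {x : Fin 1 → ℝ | x 0 ∈ Set.Icc (α:ℝ) β} ∧ R.integrand = fun x => f (x 0) :=
    ⟨⟨_, fun x => f (x 0), hCsa, hf, hfi⟩, rfl, rfl⟩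
  -- (i) ONE null modification (rule 1): `[N] − [R] ∈ relations`
  have hNR : of N - of R ∈ relations := by
    refine of_sub_of_mem_relations_of_null N R ?_ ?_ fun x hx => ?_
    · rw [hNd, hRd, Set.sdiff_eq_empty.mpr ?_, measure_empty]
      exact fun x hx => Set.Ioo_subset_Icc_self hx
    · rw [hNd, hRd]
      exact hnull
    · rw [hRi, hNi hx.1]
  -- (ii) ONE Newton–Leibniz move over `ℝ⁰` (rule 3): `[R] − [Z] ∈ newtonLeibnizRel`
  have hs0 : ∀ (x : Fin 0 → ℝ) (t : ℝ), (Fin.snoc x t : Fin 1 → ℝ) 0 = t := fun _ _ => rfl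
  have hRZ : of R - of Z ∈ newtonLeibnizRel := by
    refine ⟨0, R, Z, fun _ => (α:ℝ), fun _ => (β:ℝ),
      fun z => (Polynomial.aeval (z 0) PF : ℝ) / Polynomial.aeval (z 0) QF, ?_, ?_, ?_,
      fun _ _ => hαβ', ?_, ?_, ?_, ?_, rfl⟩
    · rw [hRd]
      exact isSemialgebraicFunOn_polynomial_div hCsa PF QF fun x hx => hQF (x 0) hx
    · rw [hZd]
      exact isSemialgebraicFunOn_ratCast isSemialgebraic_univ α
    · rw [hZd]
      exact isSemialgebraicFunOn_ratCast isSemialgebraic_univ β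
    · rw [hRd, hZd]
      ext z
      simp only [Set.mem_setOf_eq, Set.mem_Icc, Set.mem_univ, true_and]
      rfl
    · -- continuity of the primitive on the closed fibre `[α, β]`
      intro x _
      simp only [hs0]
      exact ((Polynomial.continuous_aeval PF).continuousOn).div
        (Polynomial.continuous_aeval QF).continuousOn hQF
    · -- its derivative on the open fibre is the integrand `f`
      intro x _ t ht
      rw [hRi]
      simp only [hs0]
      exact hderiv t ht
    · -- the boundary term is the constant of `Z`
      intro x _
      simp only [hZi, hs0]
  have hsplit : of N - of Z = (of N - of R) + (of R - of Z) := by abel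
  rw [hsplit]
  exact relations.add_mem hNR (newtonLeibnizRel_subset_relations hRZ)

end SlabPointNullGlue

end Summit.KontsevichZagierPeriods.HurwitzMicroSectors.NormalFormPrinciple.PiBox

end
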